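import Summits.QuantumFields.YangMills.Theorems.ScalingWindowSplitSelfNormalisedSkewnessStubWickSquares
import HarnessLib

/-!
# Crux `SelfNormalisedSkewness` (stmt-QuantumFields-18944, line `Sketch`): stub — sums of Wick squares

Linearity on top of the single-vector Wick-square identities of
`ScalingWindowSplitSelfNormalisedSkewnessStubWickSquares` (`integral_wickSquare_mul_wickSquare`,
`integral_wickSquare_mul_wickSquare_mul_wickSquare`).  For the standard Gaussian `γ = stdGaussian W`
of a finite-dimensional real inner product space `W` and finite families `a : ι → W`, `b : κ → W`,
`c : τ → W`, the sums of centred squares `S_a(x) = ∑ i, (⟪a i, x⟫² - ‖a i‖²)` satisfy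

* `E[S_a S_b] = 2 ∑ i j, ⟪a i, b j⟫²`,
* `E[S_a S_b S_c] = 8 ∑ i j l, ⟪a i, b j⟫ ⟪b j, c l⟫ ⟪c l, a i⟫`,

and `S_a S_b`, `S_a S_b S_c` are `γ`-integrable (Isserlis 1918 / Wick, summed termwise).
-/

noncomputable section

open MeasureTheory ProbabilityTheory
open scoped InnerProductSpace BigOperators

namespace Summit.QuantumFields.YangMills.Theorems.SelfNormalisedSkewness.Negative

section WickSquaresSumsHelpers

variable {W : Type*} [NormedAddCommGroup W] [InnerProductSpace ℝ W] [FiniteDimensional ℝ W]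
  [MeasurableSpace W] [BorelSpace W]

/-- The product of two Wick squares `(⟪a,x⟫² - ‖a‖²)(⟪b,x⟫² - ‖b‖²)` is `γ`-integrable. [folklore] -/
theorem integrable_wickSquare_mul_wickSquare (a b : W) :
    Integrable (fun x : W => (⟪a, x⟫_ℝ ^ 2 - ‖a‖ ^ 2) * (⟪b, x⟫_ℝ ^ 2 - ‖b‖ ^ 2))
      (stdGaussian W) := by
  have e : (fun x : W => (⟪a, x⟫_ℝ ^ 2 - ‖a‖ ^ 2) * (⟪b, x⟫_ℝ ^ 2 - ‖b‖ ^ 2)) =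
      fun x : W => ⟪a, x⟫_ℝ ^ 2 * ⟪b, x⟫_ℝ ^ 2 - ‖a‖ ^ 2 * ⟪b, x⟫_ℝ ^ 2 -
        ‖b‖ ^ 2 * ⟪a, x⟫_ℝ ^ 2 + ‖a‖ ^ 2 * ‖b‖ ^ 2 := by
    funext x; ring
  rw [e]
  exact (((integrable_inner_sq_mul_sq a b).sub'
    ((integrable_inner_pow_stdGaussian b 2).const_mul _)).sub'
    ((integrable_inner_pow_stdGaussian a 2).const_mul _)).fun_add (integrable_const _)

/-- The product of three Wick squares `(⟪a,x⟫² - ‖a‖²)(⟪b,x⟫² - ‖b‖²)(⟪c,x⟫² - ‖c‖²)` is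
`γ`-integrable. [folklore] -/
theorem integrable_wickSquare_mul_wickSquare_mul_wickSquare (a b c : W) :
    Integrable (fun x : W => (⟪a, x⟫_ℝ ^ 2 - ‖a‖ ^ 2) * (⟪b, x⟫_ℝ ^ 2 - ‖b‖ ^ 2) *
      (⟪c, x⟫_ℝ ^ 2 - ‖c‖ ^ 2)) (stdGaussian W) := by
  have e : (fun x : W => (⟪a, x⟫_ℝ ^ 2 - ‖a‖ ^ 2) * (⟪b, x⟫_ℝ ^ 2 - ‖b‖ ^ 2) *
      (⟪c, x⟫_ℝ ^ 2 - ‖c‖ ^ 2)) =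
      fun x : W => ⟪a, x⟫_ℝ ^ 2 * ⟪b, x⟫_ℝ ^ 2 * ⟪c, x⟫_ℝ ^ 2 -
        ‖a‖ ^ 2 * (⟪b, x⟫_ℝ ^ 2 * ⟪c, x⟫_ℝ ^ 2) - ‖b‖ ^ 2 * (⟪a, x⟫_ℝ ^ 2 * ⟪c, x⟫_ℝ ^ 2) +
        ‖a‖ ^ 2 * ‖b‖ ^ 2 * ⟪c, x⟫_ℝ ^ 2 -
        ‖c‖ ^ 2 * ((⟪a, x⟫_ℝ ^ 2 - ‖a‖ ^ 2) * (⟪b, x⟫_ℝ ^ 2 - ‖b‖ ^ 2)) := by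
    funext x; ring
  rw [e]
  exact ((((integrable_inner_sq_mul_sq_mul_sq a b c).sub'
    ((integrable_inner_sq_mul_sq b c).const_mul _)).sub'
    ((integrable_inner_sq_mul_sq a c).const_mul _)).fun_add
    ((integrable_inner_pow_stdGaussian c 2).const_mul _)).sub'
    ((integrable_wickSquare_mul_wickSquare a b).const_mul _)

end WickSquaresSumsHelpers

/-- **Stub — sums of Gaussian Wick squares: covariance and third moment** (line `Sketch` of crux
`SelfNormalisedSkewness`, registered signature verbatim).  For the standard Gaussian `γ` of a
finite-dimensional real inner product space and finite families of vectors `a`, `b`, `c`, the sums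
`S_a = ∑ i, (⟪a i, x⟫² - ‖a i‖²)` of centred squares satisfy `E[S_a S_b] = 2 ∑ i j, ⟪a i, b j⟫²` and
`E[S_a S_b S_c] = 8 ∑ i j l, ⟪a i, b j⟫ ⟪b j, c l⟫ ⟪c l, a i⟫`, with both products integrable
(bilinearity/trilinearity over the single-vector Isserlis–Wick identities). [folklore] -/
theorem stub_wickSquaresSums {W : Type} [NormedAddCommGroup W] [InnerProductSpace ℝ W] [FiniteDimensional ℝ W] [MeasurableSpace W] [BorelSpace W] {ι κ τ : Type} [Fintype ι] [Fintype κ] [Fintype τ] (a : ι → W) (b : κ → W) (c : τ → W) : Integrable (fun x : W => (∑ i, (⟪a i, x⟫_ℝ ^ 2 - ‖a i‖ ^ 2)) * (∑ j, (⟪b j, x⟫_ℝ ^ 2 - ‖b j‖ ^ 2))) (stdGaussian W) ∧ Integrable (fun x : W => (∑ i, (⟪a i, x⟫_ℝ ^ 2 - ‖a i‖ ^ 2)) * (∑ j, (⟪b j, x⟫_ℝ ^ 2 - ‖b j‖ ^ 2)) * (∑ l, (⟪c l, x⟫_ℝ ^ 2 - ‖c l‖ ^ 2))) (stdGaussian W)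 ∧ (∫ x, (∑ i, (⟪a i, x⟫_ℝ ^ 2 - ‖a i‖ ^ 2)) * (∑ j, (⟪b j, x⟫_ℝ ^ 2 - ‖b j‖ ^ 2)) ∂(stdGaussian W) = 2 * ∑ i, ∑ j, ⟪a i, b j⟫_ℝ ^ 2) ∧ (∫ x, (∑ i, (⟪a i, x⟫_ℝ ^ 2 - ‖a i‖ ^ 2)) * (∑ j, (⟪b j, x⟫_ℝ ^ 2 - ‖b j‖ ^ 2)) * (∑ l, (⟪c l, x⟫_ℝ ^ 2 - ‖c l‖ ^ 2)) ∂(stdGaussian W) = 8 * ∑ i, ∑ j, ∑ l, ⟪a i, b j⟫_ℝ * ⟪b j, c l⟫_ℝ * ⟪c l, a i⟫_ℝ) := by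
  -- pointwise expansion of the products of sums into iterated sums
  have h3 : ∀ x : W, (∑ i, (⟪a i, x⟫_ℝ ^ 2 - ‖a i‖ ^ 2)) * (∑ j, (⟪b j, x⟫_ℝ ^ 2 - ‖b j‖ ^ 2)) *
      (∑ l, (⟪c l, x⟫_ℝ ^ 2 - ‖c l‖ ^ 2)) =
      ∑ i, ∑ j, ∑ l, (⟪a i, x⟫_ℝ ^ 2 - ‖a i‖ ^ 2) * (⟪b j, x⟫_ℝ ^ 2 - ‖b j‖ ^ 2) *
        (⟪c l, x⟫_ℝ ^ 2 - ‖c l‖ ^ 2) := by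
    intro x
    rw [Finset.sum_mul_sum, Finset.sum_mul]
    refine Finset.sum_congr rfl fun i _ => ?_
    rw [Finset.sum_mul]
    refine Finset.sum_congr rfl fun j _ => ?_
    rw [Finset.mul_sum]
  have h2 : ∀ x : W, (∑ i, (⟪a i, x⟫_ℝ ^ 2 - ‖a i‖ ^ 2)) * (∑ j, (⟪b j, x⟫_ℝ ^ 2 - ‖b j‖ ^ 2)) =
      ∑ i, ∑ j, (⟪a i, x⟫_ℝ ^ 2 - ‖a i‖ ^ 2) * (⟪b j, x⟫_ℝ ^ 2 - ‖b j‖ ^ 2) :=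
    fun x => Finset.sum_mul_sum _ _ _ _
  -- termwise integrability
  have I2 : ∀ i j, Integrable (fun x : W => (⟪a i, x⟫_ℝ ^ 2 - ‖a i‖ ^ 2) *
      (⟪b j, x⟫_ℝ ^ 2 - ‖b j‖ ^ 2)) (stdGaussian W) :=
    fun i j => integrable_wickSquare_mul_wickSquare (a i) (b j)
  have I3 : ∀ i j l, Integrable (fun x : W => (⟪a i, x⟫_ℝ ^ 2 - ‖a i‖ ^ 2) *
      (⟪b j, x⟫_ℝ ^ 2 - ‖b j‖ ^ 2) * (⟪c l, x⟫_ℝ ^ 2 - ‖c l‖ ^ 2)) (stdGaussian W) :=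
    fun i j l => integrable_wickSquare_mul_wickSquare_mul_wickSquare (a i) (b j) (c l)
  have I2s : ∀ i, Integrable (fun x : W => ∑ j, (⟪a i, x⟫_ℝ ^ 2 - ‖a i‖ ^ 2) *
      (⟪b j, x⟫_ℝ ^ 2 - ‖b j‖ ^ 2)) (stdGaussian W) :=
    fun i => integrable_finsetSum _ fun j _ => I2 i j
  have I3s : ∀ i j, Integrable (fun x : W => ∑ l, (⟪a i, x⟫_ℝ ^ 2 - ‖a i‖ ^ 2) *
      (⟪b j, x⟫_ℝ ^ 2 - ‖b j‖ ^ 2) * (⟪c l, x⟫_ℝ ^ 2 - ‖c l‖ ^ 2)) (stdGaussian W) :=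
    fun i j => integrable_finsetSum _ fun l _ => I3 i j l
  have I3ss : ∀ i, Integrable (fun x : W => ∑ j, ∑ l, (⟪a i, x⟫_ℝ ^ 2 - ‖a i‖ ^ 2) *
      (⟪b j, x⟫_ℝ ^ 2 - ‖b j‖ ^ 2) * (⟪c l, x⟫_ℝ ^ 2 - ‖c l‖ ^ 2)) (stdGaussian W) :=
    fun i => integrable_finsetSum _ fun j _ => I3s i j
  simp_rw [h3, h2]
  refine ⟨integrable_finsetSum _ fun i _ => I2s i, integrable_finsetSum _ fun i _ => I3ss i, ?_, ?_⟩
  · rw [integral_finsetSum _ fun i _ => I2s i, Finset.mul_sum]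
    refine Finset.sum_congr rfl fun i _ => ?_
    rw [integral_finsetSum _ fun j _ => I2 i j, Finset.mul_sum]
    refine Finset.sum_congr rfl fun j _ => ?_
    exact integral_wickSquare_mul_wickSquare (a i) (b j)
  · rw [integral_finsetSum _ fun i _ => I3ss i, Finset.mul_sum]
    refine Finset.sum_congr rfl fun i _ => ?_
    rw [integral_finsetSum _ fun j _ => I3s i j, Finset.mul_sum]
    refine Finset.sum_congr rfl fun j _ => ?_
    rw [integral_finsetSum _ fun l _ => I3 i j l, Finset.mul_sum]
    refine Finset.sum_congr rfl fun l _ => ?_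
    exact (integral_wickSquare_mul_wickSquare_mul_wickSquare (a i) (b j) (c l)).trans (by ring)

end Summit.QuantumFields.YangMills.Theorems.SelfNormalisedSkewness.Negative

end
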